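import Summits.RiemannHypothesis.RiemannHypothesis.Theorems.TiltedLandingLaw421R3Lens1Pinning
import Summits.RiemannHypothesis.RiemannHypothesis.Theorems.TiltedLandingLaw421R3RateSkeleton
import Summits.RiemannHypothesis.RiemannHypothesis.Theses.EarlyAppointments

/-! # trkD_v11q (half) — UPGRADE DRAFT-1 (director-rh g23 (CA533)) — skeleton for `TiltedLandingLaw421R` at `halfPurse`; v10q 346793ab with the SUCC residual
`RegHungCut10S` split ONCE MORE by lens-1ʼs PROVED pinning doors (module (3o) `…R3Lens1Pinning`, image `lens-1/Pinning-v1.lean` 26c0ec5a; kernel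
`RhW08.Lens1Pinning.regHungCut10S_of_topPinning : TopPinning → RegUmbrella11S → RegHungCut10S`, converse `regUmbrella11S_of_regHungCut10S` for the residual):
SUCC — an analytic LAW + ONE residual, both in BAND currency:
  `stub_topPinning : RhW08.Lens1Pinning.TopPinning` — TOP-OF-CLUSTER PINNING (crit-1 L★★★ typed verbatim): on a legal frame, an upper zero a of f⁽ʲ⁾ with NO strictly taller
  disc-toucher (`NoTallerToucher`: ∀ b, f⁽ʲ⁾ b = 0 → Im a < Im b → Im a + Im b < |Re a − Re b|) has a non-real zero of f⁽ʲ⁺¹⁾ in its CLOSED Jensen disc (`NestedStep`) or a real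
  NL event under it (|x − Re a| ≤ Im a). Critic numerics 0 / 1.42 M (e^{γz}·P, deg ≤ 14, j ≤ 6); SHARP on the circle (pure tilt; equal-height twins) — proofs must tolerate
  boundary zeros (argument principle on D(1+ε), not circle-Rouché). First rung: `topPinning_isolated` (lens-1 g5 O3-a).
  `stub_regUmbrella11S : RhW08.Lens1Pinning.RegUmbrella11S` — the v10q binders + `UmbrellaTop` (the TALLEST level-j band state is disc-touched by a strictly taller zero of f⁽ʲ⁾
  that is NOT a band state — hence beyond the wall, `umbrella_beyond_wall`) ⇒ successor. = adversary program A3′ v3 end-state (crit-1/C6: 0 candidates in 1.52 M + 51 k evaluations;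
  exhibit-G geometry); lens-1 EXILE inhabitant a★ = same species (RECONCILE crit-1 l.7670 / lens-1 l.7653: one name UMBRELLA).
RATE — unchanged from v10q: F1 `FarEnergyLawCQ (4/5)`, F2c `EnergyRiseLawQ riseSupQ`, Cc `ConsLawQ consSupQ`, Ac = ★A `ApproachAllowanceQ (approachBudgetHalfQ riseSupQ consSupQ)`
(T-CE1: none fails on the criticʼs corner frame CE1; F1 margin ×1.53).
INTERFACE: `…/Theorems/TiltedLandingLaw421R3Lens1Pinning.lean` ((3o): `def TopPinning`, `def RegUmbrella11S`, `regHungCut10S_of_topPinning`), `…R3Lens1CoverageRS2` (#1145: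
`TiltedLandingLaw421R_of_regHungCut10S`), `…R3RateSkeleton` (#1146: `riseSupQ`, `consSupQ`, `rateLawsHalfQ_of_canonical`).
USE RULE (CA533): registers as `Lines/trkD_v11q.lean` only after (3o) is ACCEPTED in the tree AND desk PRE-CERT ×1 + critic PRE-PLANT ×2 on this text by import of the landed (3o)
AND crit-1ʼs costume word on `TopPinning`/`RegUmbrella11S` (given l.7670 (4): T1/T3/T4 ✓, T7 proof-risk note, T8 class caveat); v10q 346793ab stays the registry until then. -/

namespace Summit.RiemannHypothesis.RiemannHypothesis.Cruxes.TiltedLandingLaw421R.TrkDV11Q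

set_option linter.dupNamespace false

/-- OPEN SUCC analytic LAW stub (lens-1 P8 / crit-1 L★★★): `RhW08.Lens1Pinning.TopPinning`. -/
theorem stub_topPinning : RhW08.Lens1Pinning.TopPinning := by
  sorry

/-- OPEN SUCC residual stub (cell-free, SUCCESSOR conclusion, BAND currency, UMBRELLA end-state): `RhW08.Lens1Pinning.RegUmbrella11S`. -/
theorem stub_regUmbrella11S : RhW08.Lens1Pinning.RegUmbrella11S := by
  sorry

/-- OPEN RATE stub F1 (lens-2): the far-chain energy law `RhW08.SealSwapQ.FarEnergyLawCQ (4/5)`. -/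
theorem stub_farEnergyLawCQ : RhW08.SealSwapQ.FarEnergyLawCQ (4 / 5) := by
  sorry

/-- OPEN RATE stub F2c: energy-rise law at the canonical budget `RhW08.BurgersRateG3.riseSupQ`. -/
theorem stub_energyRiseC : RhW08.SealSwapQ.EnergyRiseLawQ RhW08.BurgersRateG3.riseSupQ := by
  sorry

/-- OPEN RATE stub Cc: conservative-cost law at the canonical budget `RhW08.BurgersRateG3.consSupQ`. -/
theorem stub_consC : RhW08.SealSwapQ.ConsLawQ RhW08.BurgersRateG3.consSupQ := by
  sorry

/-- OPEN RATE stub Ac = ★A: the approach allowance at the canonical budgets (the one analytic inequality of the non-far half). -/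
theorem stub_approachC :
    RhW08.SealSwapQ.ApproachAllowanceQ (RhW08.RateSplit.approachBudgetHalfQ RhW08.BurgersRateG3.riseSupQ RhW08.BurgersRateG3.consSupQ) := by
  sorry

/-- The crux BY NAME from the six stubs (`TiltedLandingLaw421R_of_regHungCut10S` ∘ `regHungCut10S_of_topPinning` ∘ `rateLawsHalfQ_of_canonical`). -/
theorem TiltedLandingLaw421R_of : Summit.RiemannHypothesis.RiemannHypothesis.Theses.EarlyAppointments.TiltedLandingLaw421R :=
  RhW08.Lens1Coverage.TiltedLandingLaw421R_of_regHungCut10S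
    (RhW08.Lens1Pinning.regHungCut10S_of_topPinning stub_topPinning stub_regUmbrella11S)
    (RhW08.BurgersRateG3.rateLawsHalfQ_of_canonical stub_farEnergyLawCQ stub_energyRiseC stub_consC stub_approachC)

end Summit.RiemannHypothesis.RiemannHypothesis.Cruxes.TiltedLandingLaw421R.TrkDV11Q
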